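import Literature.MathematicalPhysics.PowerSystems.RingLongLineResistanceCriterion
import HarnessLib

/-!
# Bronski–DeVille–Ferguson's index theorem on the RING (Theorem 2.6, one-cycle case `𝒵 = −Σ1/γᵢ`):
# a ring fixed point with `j` lines beyond `π/2` has type EXACTLY `j` if `Σᵢ 1/γᵢ > 0` and EXACTLY
# `j − 1` if `Σᵢ 1/γᵢ < 0` (`γᵢ = P_{i,i+1}cos(θᵢ − θᵢ₊₁)`), first-order and swing tiers

Topic `Literature/MathematicalPhysics/PowerSystems`; namespaces `…PowerSystems.SignedCycle` (§1–§6,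
linear algebra of the signed cycle form), `…NonuniformKuramoto` (§7), `…ClassicalModel.
LosslessSystem` (§8). Everything is PROVED: 0 definitions, 0 named facts, 0 `sorry`. Sequel of
`RingLongLineResistanceCriterion.lean` (ONE inverted line: `(n₋, n₀, n₊) = (1, 1, m − 1)` beyond the
effective-resistance threshold — the case `j = 1` below) and of `SignedLaplacianInertiaBounds.lean`
(Bronski–DeVille 2014 Thm 2.8: on a ring with `j ≥ 1` inverted lines `c(Γ₊) = j`, `c(Γ₋) = m + 1 −
j`, so the type is `j − 1` or `j` and the flexibility is `1` — ONE weight-dependent eigenvalue;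
this file says WHICH, by the sign of the `1 × 1` cycle intersection form). Reused UNCHANGED:
`SignedCycle.ring_linForm_eq` (§G63), the kernel-form Courant–Fischer counts
`NonuniformKuramoto.card_eigenvalues_{pos,nonneg,neg,nonpos}_le_of_…_on_ker`, `RefNode.refMinor_counts`
and the root counts `countP_roots_charpoly_toDroopNetwork_auxJac` /
`countP_roots_charpoly_phaseJac_modRotation`, Mathlib's square-root-free Cauchy–Schwarz
`Finset.sum_sq_le_sum_mul_sum_of_sq_le_mul`.

SOURCE (held LaTeX, read on the page: `lit read arxiv:1508.01507`). J. C. Bronski, L. DeVille,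
T. Ferguson, *Graph homology and stability of coupled oscillator networks*, SIAM J. Appl. Math.
**76** (2016) 1126–1151 [BronskiDeVilleFerguson2016]. §1 (p0003): the Laplacian `(ℒ_G)_{vw} =
γ_{vw}` (`v ≠ w`), `−Σ_u γ_{vu}` (`v = w`) («Our Laplacian is the negative of the standard
definition»); the bounds `|G₊| − 1 ≤ n₊(G) ≤ |V| − |G₋|` of [BronskiDeVille2014]; §1.1 eqs.
(Kuramoto) `θ̇ᵢ = ωᵢ + Σ δᵢⱼ sin(θⱼ − θᵢ)` and (swing) `Mθ̈ᵢ + Dθ̇ᵢ = ωᵢ + Σ δᵢⱼ sin(θⱼ − θᵢ)`, «In each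
of these examples the dimension of the unstable manifold to a fixed point of the equations is given
by the number of positive eigenvalues of a graph Laplacian» (p0003 L82–L110). §2.1 Definition 2.2
(spectral index `(n₊, n₀, n₋)`, reduced determinant `detred`, «`detred(ℒ_G) = 0` iff `ℒ_G` has a
nonsimple eigenvalue at `0`»), Definition 2.3 (incidence matrix, cycle space, cycle rank `C = |E| −
|V| + 1`), Definition 2.4 (cycle intersection form `𝒵_G := −Y_Gᵀ D_G⁻¹ Y_G`, `(𝒵_G)ᵢⱼ = −Σₑ γₑ⁻¹
y_{i,e}y_{j,e}`), Lemma 2.5 (`ℒ_G = −B_G D_G B_Gᵀ`) (p0005 L1–L112). §2.2 **Theorem 2.6**: «Let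
`G = (V,E,Γ)` be a connected, weighted graph and let `ℒ_G` be its Laplacian matrix. Then the number
of positive eigenvalues of the Laplacian is the number of negative edges in the graph minus the
number of positive eigenvalues of the cycle intersection matrix, i.e. `n₊(ℒ_G) = #{e ∈ E | γₑ < 0}
− n₊(𝒵_G)`» (p0005 L116–L140); **Theorem 2.8**: `(1/N_G)·detred(ℒ_G) = det(𝒵(G)) × Πₑ γₑ` (p0006
L56–L76). §3.2 **One-cycle graphs**: «consider `R_N`, the ring graph on `N` vertices … edge `i`
goes from `i → i+1`, modulo `N`. The cycle can be represented by the vector `𝟏`, and thus we have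
`Z_G` is the `1 × 1` matrix (i.e. the scalar) `Z_G = −Σᵢ₌₁ᴺ 1/γᵢ`. Thus to obtain a stable
Laplacian, we need that `Z_G > 0`, or `Σᵢ 1/γᵢ < 0`. Assuming that `γ₁ < 0` and the remainder are
positive, the condition for stability is `γ₁ > −1/Σᵢ₌₂ⁿ 1/γᵢ`» (p0007 last § – p0008 L1–L20). Type
= root count of the reduced system: [Chiang1995] §6 Thm 6.1 / 6.7.

RENDERING. Nodes `Fin (m+1)`; edges `(i, ρ i)` with `ρ = finRotate (m+1)` (the print's «edge `i`
goes from `i → i+1` modulo `N`»); non-zero weights `γ : Fin (m+1) → ℝ`; `H` any real symmetric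
matrix with `xᵀHx = Σᵢ γᵢ(x_{ρi} − xᵢ)²` — the HESSIAN sign, `H = −ℒ_G`, so the print's `n₊(ℒ_G)`
is `n₋(H)` here (for a connected simple ring take `m + 1 ≥ 3`; §1–§5 hold for every `m`). `j :=
#{i : γᵢ < 0}`. In the models `γᵢ = P_{i,ρi}cos(θᵢ − θ_{ρi})` (`C` for the swing tier), the coupling
is symmetric and SUPPORTED ON THE RING (`P i j ≠ 0 ⇒ j = ρ i ∨ i = ρ j`), `m + 1 ≥ 3`.

WHAT IS PROVED.
* §1 `exists_eigenvalues_eq_zero` (`ℒ𝟏 = 0` from the form); §2–§4 six kernel-form counts (private)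
  resting on ★ `form_neg_or_zero_of_posCurrents` / ★ `form_pos_or_zero_of_negCurrents` (equal
  currents `γᵢdᵢ = c` on the positive (negative) edges, `Σdᵢ = 0`, `Σ1/γᵢ > 0` (`< 0`) ⇒ the
  form is `< 0` (`> 0`) unless `d = 0` — the `1 × 1` intersection form at work, by Cauchy–Schwarz on
  the other edge class).
* §5 ★★★ **`inertia_of_sum_inv_pos`** (`Σ1/γᵢ > 0 ⇒ (n₋, n₀, n₊)(H) = (j, 1, m − j)`),
  ★★★ **`inertia_of_sum_inv_neg`** (`Σ1/γᵢ < 0 ⇒ (j − 1, 1, m + 1 − j)`),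
  ★★ **`inertia_of_sum_inv_eq_zero`** (`Σ1/γᵢ = 0 ⇒ (j − 1, 2, m − j)`: the crossing, `detred = 0`),
  `form_of_unit_currents` (the second kernel direction at the crossing).
* §6 `ring_linForm_eq_sum_rotate` (ring-supported linearised form = cycle form over `ρ`).
* §7 FIRST-ORDER RING (`Kur : NonuniformKuramoto (m+1)`, `m + 1 ≥ 3`, lossless, symmetric `P` on
  the ring, ANY `ω`, ANY `Dᵢ > 0`, every `γᵢ ≠ 0`): `ring_lap_form`, ★★★
  **`ring_type_auxJac_of_sum_inv_pos`** (`Σ1/γᵢ > 0` ⇒ RHP `= j`, LHP `= m − j`, axis `= 1`), ★★★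
  **`ring_type_auxJac_of_sum_inv_neg`** (`Σ1/γᵢ < 0` ⇒ RHP `= j − 1`, LHP `= m + 1 − j`, axis `= 1`),
  ★★ `ring_inertia_lap_of_sum_inv_eq_zero` (the crossing: double zero of `L(θ)`, no type).
* §8 SWING RING (`S : ClassicalModel.LosslessSystem (m+1) 0`, `Mᵢ, Dᵢ > 0`, `C` symmetric on the
  ring): `ring_hessMatrix_form`, ★★★ **`ring_type_phaseJac_of_sum_inv_pos`** (RHP `= j`, LHP `= (m
  − j) + (m + 1)`, axis `= 1`), ★★★ **`ring_type_phaseJac_of_sum_inv_neg`** (RHP `= j − 1`).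

PROOF ROUTE (documented deviation). The print realises `ℒ_G` as the restriction of a covering-tree
Laplacian and applies the Haynsworth inertia formula, `n₊(M) = n₊(M|_S) + n₊(M⁻¹|_{S⊥})`. On one
cycle the whole content is the signature of the diagonal form `Σγᵢdᵢ²` on the hyperplane `Σdᵢ = 0`
(the differences `dᵢ = x_{ρi} − xᵢ` range over it), which is decided by the `D`-orthogonal vector
`(1/γᵢ)ᵢ` of square `Σ1/γᵢ = −𝒵`; this is typed as six Courant–Fischer counts in kernel form —
on `{dᵢ = 0 on the negative edges, x₀ = 0}` the form is `> 0` (`#{λ ≤ 0} ≤ j + 1`), on `{equal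
currents γᵢdᵢ on the positive edges, x₀ = 0}` it is `c²Σ₊1/γ − Σ₋|γ|d²` with `(cΣ₊1/γ)² = (Σ₋d)²
≤ (Σ₋1/|γ|)(Σ₋|γ|d²)`, hence `< 0` when `Σ₊1/γ > Σ₋1/|γ|` (`#{λ ≥ 0} ≤ m + 1 − j`), and the four
mirror / non-strict variants; the partition `n₋ + n₀ + n₊ = m + 1` pins the three counts in each
case. In-seat exact cross-check (own rational Lagrange congruence diagonalisation, plain python,
`negtest/bdf_cycle_check.py` in the seat folder): 600 random rings, `N = 1…8`, 255 / 243 / 102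
instances of the three cases — all inertias as stated.

THREE COLUMNS. CERTIFIED: kernel theorems — for exact ring data (`m + 1 ≥ 3` buses, lossless
symmetric lines) the TYPE of ANY non-degenerate fixed point is read off the signs of the `m + 1`
line weights `γᵢ` and of the single number `Σᵢ 1/γᵢ`, in both model tiers: `j` inverted lines give
type `j` (`Σ1/γᵢ > 0`) or `j − 1` (`Σ1/γᵢ < 0`); in particular two or more inverted lines are never
stable (type `≥ 1`), and one inverted line is stable iff `Σ1/γᵢ < 0` (= `a·Σ1/bₖ > 1` fails, §G63).
MODELLED: first-order Kuramoto / droop ring, classical swing ring; lossless, symmetric. NOT CLAIMED: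
general graphs with cycle rank `C ≥ 2` (Theorem 2.6 with a `C × C` intersection form — not typed),
unicyclic graphs with pendant trees (each pendant inverted line adds one to the type by
`TreeNetworkFixedPointIndex`-type arguments — not typed here), the dynamics at the crossing.
-/

noncomputable section

open Real Set Filter Topology Metric Finset Matrix
open scoped Matrix

namespace Literature.MathematicalPhysics.PowerSystems

namespace SignedCycle

variable {m : ℕ}

/-! ### §1. The signed cycle: edges `(i, ρ i)`, `ρ = finRotate (m+1)`, weights `γᵢ ≠ 0`,
form `Q(x) = Σᵢ γᵢ (x_{ρ i} − xᵢ)²` -/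

/-- `ρ (castSucc k) = succ k`: the ring edges `(i, ρ i)` are the path edges `(k, k+1)` and the
closing edge `(m, 0)`. [folklore] -/
private theorem finRotate_castSucc' (k : Fin m) : finRotate (m + 1) k.castSucc = k.succ := by
  apply Fin.ext
  rw [coe_finRotate_of_ne_last (fun h => by
    have := congrArg Fin.val h; rw [Fin.val_castSucc, Fin.val_last] at this; have := k.2; omega),
    Fin.val_castSucc, Fin.val_succ]

/-- The edge differences around the cycle telescope: `Σᵢ (x_{ρ i} − xᵢ) = 0`. [folklore] -/
private theorem sum_diff_eq_zero (x : Fin (m + 1) → ℝ) :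
    ∑ i, (x (finRotate (m + 1) i) - x i) = 0 := by
  rw [Finset.sum_sub_distrib, Equiv.sum_comp (finRotate (m + 1)) x, sub_self]

/-- Zero differences around the cycle force a constant vector. [folklore] -/
private theorem const_of_diff_eq_zero {x : Fin (m + 1) → ℝ}
    (h : ∀ i, x (finRotate (m + 1) i) - x i = 0) (i : Fin (m + 1)) : x i = x 0 := by
  induction i using Fin.induction with
  | zero => rfl
  | succ k ih =>
    have hk := h k.castSucc
    rw [finRotate_castSucc', sub_eq_zero] at hk
    rw [hk, ih]

/-- With all weights non-zero, «not positive» is «negative». [folklore] -/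
private theorem filter_not_pos_eq {γ : Fin (m + 1) → ℝ} (hγ : ∀ i, γ i ≠ 0) :
    (univ.filter fun i => ¬ 0 < γ i) = (univ.filter fun i => γ i < 0) := by
  refine Finset.filter_congr fun i _ => ?_
  constructor
  · intro h; exact lt_of_le_of_ne (not_lt.1 h) (hγ i)
  · intro h; exact not_lt.2 h.le

/-- Splitting a sum over the edges into the positive and the negative edges. [folklore] -/
private theorem sum_eq_sum_pos_add_sum_neg {γ : Fin (m + 1) → ℝ} (hγ : ∀ i, γ i ≠ 0)
    (f : Fin (m + 1) → ℝ) :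
    ∑ i, f i = ∑ i ∈ univ.filter (fun i => 0 < γ i), f i
      + ∑ i ∈ univ.filter (fun i => γ i < 0), f i := by
  rw [← filter_not_pos_eq hγ, Finset.sum_filter_add_sum_filter_not]

/-- The two edge classes partition the `m + 1` edges. [folklore] -/
private theorem card_pos_add_card_neg {γ : Fin (m + 1) → ℝ} (hγ : ∀ i, γ i ≠ 0) :
    (univ.filter fun i => 0 < γ i).card + (univ.filter fun i => γ i < 0).card = m + 1 := by
  rw [← filter_not_pos_eq hγ, Finset.card_filter_add_card_filter_not, Finset.card_univ,
    Fintype.card_fin]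

/-- Cauchy–Schwarz on the positive edges, square-root free:
`(Σ_{γ>0} dᵢ)² ≤ (Σ_{γ>0} 1/γᵢ) · (Σ_{γ>0} γᵢdᵢ²)`. [folklore] -/
private theorem sq_sum_le_pos (γ d : Fin (m + 1) → ℝ) :
    (∑ i ∈ univ.filter (fun i => 0 < γ i), d i) ^ 2
      ≤ (∑ i ∈ univ.filter (fun i => 0 < γ i), 1 / γ i)
        * ∑ i ∈ univ.filter (fun i => 0 < γ i), γ i * d i ^ 2 := by
  refine Finset.sum_sq_le_sum_mul_sum_of_sq_le_mul _ (fun i hi => ?_) (fun i hi => ?_)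
    (fun i hi => ?_)
  · exact (one_div_pos.2 (Finset.mem_filter.1 hi).2).le
  · exact mul_nonneg (Finset.mem_filter.1 hi).2.le (sq_nonneg _)
  · have hg : 0 < γ i := (Finset.mem_filter.1 hi).2
    have : 1 / γ i * (γ i * d i ^ 2) = d i ^ 2 := by
      rw [← mul_assoc, one_div_mul_cancel hg.ne', one_mul]
    rw [this]

/-- Cauchy–Schwarz on the negative edges: `(Σ_{γ<0} dᵢ)² ≤ (Σ_{γ<0} (−1/γᵢ)) · (Σ_{γ<0} (−γᵢ)dᵢ²)`.
[folklore] -/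
private theorem sq_sum_le_neg (γ d : Fin (m + 1) → ℝ) :
    (∑ i ∈ univ.filter (fun i => γ i < 0), d i) ^ 2
      ≤ (∑ i ∈ univ.filter (fun i => γ i < 0), -(1 / γ i))
        * ∑ i ∈ univ.filter (fun i => γ i < 0), -γ i * d i ^ 2 := by
  refine Finset.sum_sq_le_sum_mul_sum_of_sq_le_mul _ (fun i hi => ?_) (fun i hi => ?_)
    (fun i hi => ?_)
  · have hg : γ i < 0 := (Finset.mem_filter.1 hi).2
    rw [neg_nonneg]; exact (one_div_neg.2 hg).le
  · exact mul_nonneg (neg_nonneg.2 (Finset.mem_filter.1 hi).2.le) (sq_nonneg _)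
  · have hg : γ i < 0 := (Finset.mem_filter.1 hi).2
    have h1 : -(1 / γ i) * (-γ i * d i ^ 2) = 1 / γ i * (γ i * d i ^ 2) := by ring
    rw [h1, ← mul_assoc, one_div_mul_cancel hg.ne, one_mul]

/-- **`ℒ𝟙 = 0` for the cycle**: a real symmetric matrix whose form is a function of the edge
differences has `0` as an eigenvalue. [cite: BronskiDeVilleFerguson2016, §2.1 Definition 2.2 («for any `G`, `ℒ_G 𝟏 = 𝟎`, `ℒ_G` has a zero eigenvalue», arXiv:1508.01507 p0005 L30–L34)] -/
theorem exists_eigenvalues_eq_zero {γ : Fin (m + 1) → ℝ} {H : Matrix (Fin (m + 1)) (Fin (m + 1)) ℝ}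
    (hH : H.IsHermitian)
    (hform : ∀ x : Fin (m + 1) → ℝ, x ⬝ᵥ H *ᵥ x = ∑ i, γ i * (x (finRotate (m + 1) i) - x i) ^ 2) :
    ∃ i, hH.eigenvalues i = 0 := by
  classical
  set one : Fin (m + 1) → ℝ := fun _ => 1 with hone_def
  have hQ1 : ∀ y : Fin (m + 1) → ℝ, (y + one) ⬝ᵥ H *ᵥ (y + one) = y ⬝ᵥ H *ᵥ y := by
    intro y
    rw [hform, hform]
    exact Finset.sum_congr rfl fun i _ => by simp [hone_def]
  have hQone : one ⬝ᵥ H *ᵥ one = 0 := by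
    rw [hform]
    simp [hone_def]
  have hT : Hᵀ = H := by
    have h := hH.eq
    rwa [conjTranspose_eq_transpose_of_trivial] at h
  have hsymm : ∀ y : Fin (m + 1) → ℝ, one ⬝ᵥ H *ᵥ y = y ⬝ᵥ H *ᵥ one := by
    intro y
    calc one ⬝ᵥ H *ᵥ y = (one ᵥ* H) ⬝ᵥ y := dotProduct_mulVec _ _ _
      _ = (Hᵀ *ᵥ one) ⬝ᵥ y := by rw [mulVec_transpose]
      _ = (H *ᵥ one) ⬝ᵥ y := by rw [hT]
      _ = y ⬝ᵥ H *ᵥ one := dotProduct_comm _ _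
  have horth : ∀ y : Fin (m + 1) → ℝ, y ⬝ᵥ H *ᵥ one = 0 := by
    intro y
    have h := hQ1 y
    rw [mulVec_add, add_dotProduct, dotProduct_add, dotProduct_add, hsymm, hQone] at h
    linarith
  have hW1 : H *ᵥ one = 0 := dotProduct_self_eq_zero.1 (horth (H *ᵥ one))
  have hone : one ≠ 0 := fun h => by
    have := congrFun h 0
    simp [hone_def] at this
  have hdet : H.det = 0 := Matrix.exists_mulVec_eq_zero_iff.1 ⟨one, hone, hW1⟩
  have hprod := hH.det_eq_prod_eigenvalues
  rw [hdet] at hprod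
  simp only [RCLike.ofReal_real_eq_id, id_eq] at hprod
  obtain ⟨i, _, hi⟩ := Finset.prod_eq_zero_iff.1 hprod.symm
  exact ⟨i, hi⟩

/-! ### §2. Six Courant–Fischer counts in kernel form for the cycle form -/

section Counts

variable {γ : Fin (m + 1) → ℝ} {H : Matrix (Fin (m + 1)) (Fin (m + 1)) ℝ}

/-- On the cycle every edge is positive or negative when no weight vanishes. [folklore] -/
private theorem pos_or_neg (hγ : ∀ i, γ i ≠ 0) (i : Fin (m + 1)) : 0 < γ i ∨ γ i < 0 :=
  (lt_or_gt_of_ne (hγ i)).symm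

/-- A vector with all cycle differences zero and `x 0 = 0` vanishes. [folklore] -/
private theorem eq_zero_of_diff_eq_zero {x : Fin (m + 1) → ℝ}
    (h : ∀ i, x (finRotate (m + 1) i) - x i = 0) (h0 : x 0 = 0) : x = 0 := by
  funext i
  rw [const_of_diff_eq_zero h i, h0, Pi.zero_apply]

/-- **(K2)** Zero differences on the negative edges and a grounded node leave a positive definite
form: `#{λ ≤ 0} ≤ #{γ < 0} + 1`. [folklore] -/
private theorem card_nonpos_le_card_neg_succ (hγ : ∀ i, γ i ≠ 0) (hH : H.IsHermitian)
    (hform : ∀ x : Fin (m + 1) → ℝ, x ⬝ᵥ H *ᵥ x = ∑ i, γ i * (x (finRotate (m + 1) i) - x i) ^ 2) :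
    (univ.filter fun k => hH.eigenvalues k ≤ 0).card ≤ (univ.filter fun i => γ i < 0).card + 1 := by
  classical
  set Neg := univ.filter fun i => γ i < 0 with hNeg
  let D : Fin (m + 1) → ((Fin (m + 1) → ℝ) →ₗ[ℝ] ℝ) := fun i =>
    LinearMap.proj (R := ℝ) (φ := fun _ : Fin (m + 1) => ℝ) (finRotate (m + 1) i)
      - LinearMap.proj (R := ℝ) (φ := fun _ : Fin (m + 1) => ℝ) i
  let L : (Fin (m + 1) → ℝ) →ₗ[ℝ] ((↥Neg → ℝ) × ℝ) :=
    (LinearMap.pi fun i : ↥Neg => D i.1).prod (LinearMap.proj (R := ℝ) (φ := fun _ : Fin (m + 1) => ℝ) 0)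
  refine NonuniformKuramoto.card_eigenvalues_nonpos_le_of_pos_on_ker hH L ?_ fun x hx0 hx => ?_
  · rw [Module.finrank_prod, Module.finrank_fintype_fun_eq_card, Fintype.card_coe,
      Module.finrank_self]
  · rw [LinearMap.prod_apply, Prod.mk_eq_zero] at hx
    have hx' : (∀ i : ↥Neg, x (finRotate (m + 1) i.1) - x i.1 = 0) ∧ x 0 = 0 :=
      ⟨fun i => by simpa [D] using congrFun hx.1 i, hx.2⟩
    have hdn : ∀ i, γ i < 0 → x (finRotate (m + 1) i) - x i = 0 := fun i hi =>
      hx'.1 ⟨i, Finset.mem_filter.2 ⟨Finset.mem_univ _, hi⟩⟩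
    rw [hform, sum_eq_sum_pos_add_sum_neg hγ]
    have hneg0 : ∑ i ∈ univ.filter (fun i => γ i < 0), γ i * (x (finRotate (m + 1) i) - x i) ^ 2
        = 0 := Finset.sum_eq_zero fun i hi => by
      rw [hdn i (Finset.mem_filter.1 hi).2]; ring
    rw [hneg0, add_zero]
    have hnn : ∀ i ∈ univ.filter (fun i => 0 < γ i),
        0 ≤ γ i * (x (finRotate (m + 1) i) - x i) ^ 2 :=
      fun i hi => mul_nonneg (Finset.mem_filter.1 hi).2.le (sq_nonneg _)
    refine (Finset.sum_nonneg hnn).lt_of_ne fun h0 => hx0 (eq_zero_of_diff_eq_zero (fun i => ?_) hx'.2)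
    rcases pos_or_neg hγ i with hi | hi
    · have := (Finset.sum_eq_zero_iff_of_nonneg hnn).1 h0.symm i
        (Finset.mem_filter.2 ⟨Finset.mem_univ _, hi⟩)
      rcases mul_eq_zero.1 this with h | h
      · exact absurd h hi.ne'
      · exact pow_eq_zero_iff two_ne_zero |>.1 h
    · exact hdn i hi

/-- **(K4)** Zero differences on the positive edges and a grounded node leave a negative definite
form: `#{λ ≥ 0} ≤ #{γ > 0} + 1`. [folklore] -/
private theorem card_nonneg_le_card_pos_succ (hγ : ∀ i, γ i ≠ 0) (hH : H.IsHermitian)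
    (hform : ∀ x : Fin (m + 1) → ℝ, x ⬝ᵥ H *ᵥ x = ∑ i, γ i * (x (finRotate (m + 1) i) - x i) ^ 2) :
    (univ.filter fun k => 0 ≤ hH.eigenvalues k).card ≤ (univ.filter fun i => 0 < γ i).card + 1 := by
  classical
  set Pos := univ.filter fun i => 0 < γ i with hPos
  let D : Fin (m + 1) → ((Fin (m + 1) → ℝ) →ₗ[ℝ] ℝ) := fun i =>
    LinearMap.proj (R := ℝ) (φ := fun _ : Fin (m + 1) => ℝ) (finRotate (m + 1) i)
      - LinearMap.proj (R := ℝ) (φ := fun _ : Fin (m + 1) => ℝ) i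
  let L : (Fin (m + 1) → ℝ) →ₗ[ℝ] ((↥Pos → ℝ) × ℝ) :=
    (LinearMap.pi fun i : ↥Pos => D i.1).prod (LinearMap.proj (R := ℝ) (φ := fun _ : Fin (m + 1) => ℝ) 0)
  refine NonuniformKuramoto.card_eigenvalues_nonneg_le_of_neg_on_ker hH L ?_ fun x hx0 hx => ?_
  · rw [Module.finrank_prod, Module.finrank_fintype_fun_eq_card, Fintype.card_coe,
      Module.finrank_self]
  · rw [LinearMap.prod_apply, Prod.mk_eq_zero] at hx
    have hx' : (∀ i : ↥Pos, x (finRotate (m + 1) i.1) - x i.1 = 0) ∧ x 0 = 0 :=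
      ⟨fun i => by simpa [D] using congrFun hx.1 i, hx.2⟩
    have hdp : ∀ i, 0 < γ i → x (finRotate (m + 1) i) - x i = 0 := fun i hi =>
      hx'.1 ⟨i, Finset.mem_filter.2 ⟨Finset.mem_univ _, hi⟩⟩
    rw [hform, sum_eq_sum_pos_add_sum_neg hγ]
    have hpos0 : ∑ i ∈ univ.filter (fun i => 0 < γ i), γ i * (x (finRotate (m + 1) i) - x i) ^ 2
        = 0 := Finset.sum_eq_zero fun i hi => by
      rw [hdp i (Finset.mem_filter.1 hi).2]; ring
    rw [hpos0, zero_add]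
    have hnp : ∀ i ∈ univ.filter (fun i => γ i < 0),
        γ i * (x (finRotate (m + 1) i) - x i) ^ 2 ≤ 0 :=
      fun i hi => mul_nonpos_of_nonpos_of_nonneg (Finset.mem_filter.1 hi).2.le (sq_nonneg _)
    refine (Finset.sum_nonpos hnp).lt_of_ne fun h0 => hx0 (eq_zero_of_diff_eq_zero (fun i => ?_) hx'.2)
    rcases pos_or_neg hγ i with hi | hi
    · exact hdp i hi
    · have := (Finset.sum_eq_zero_iff_of_nonpos hnp).1 h0 i
        (Finset.mem_filter.2 ⟨Finset.mem_univ _, hi⟩)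
      rcases mul_eq_zero.1 this with h | h
      · exact absurd h hi.ne
      · exact pow_eq_zero_iff two_ne_zero |>.1 h

end Counts

/-! ### §3. The algebra of equal currents (the `1 × 1` cycle intersection form `−Σ 1/γᵢ`) -/

section Currents

variable {γ : Fin (m + 1) → ℝ}

/-- With equal currents `γᵢdᵢ = c` on the positive edges: `Σ_{γ>0} dᵢ = c·Σ_{γ>0} 1/γᵢ` and
`Σ_{γ>0} γᵢdᵢ² = c²·Σ_{γ>0} 1/γᵢ`. [folklore] -/
private theorem sums_of_posCurrents {d : Fin (m + 1) → ℝ} {c : ℝ}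
    (hcur : ∀ i, 0 < γ i → γ i * d i = c) :
    ∑ i ∈ univ.filter (fun i => 0 < γ i), d i = c * ∑ i ∈ univ.filter (fun i => 0 < γ i), 1 / γ i
      ∧ ∑ i ∈ univ.filter (fun i => 0 < γ i), γ i * d i ^ 2
          = c ^ 2 * ∑ i ∈ univ.filter (fun i => 0 < γ i), 1 / γ i := by
  have hd : ∀ i ∈ univ.filter (fun i => 0 < γ i), d i = c * (1 / γ i) := by
    intro i hi
    have hne : γ i ≠ 0 := (Finset.mem_filter.1 hi).2.ne'
    rw [← hcur i (Finset.mem_filter.1 hi).2]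
    have e : γ i * d i * (1 / γ i) = d i * (γ i * (1 / γ i)) := by ring
    rw [e, mul_one_div_cancel hne, mul_one]
  constructor
  · rw [Finset.mul_sum]
    exact Finset.sum_congr rfl hd
  · rw [Finset.mul_sum]
    refine Finset.sum_congr rfl fun i hi => ?_
    have hne : γ i ≠ 0 := (Finset.mem_filter.1 hi).2.ne'
    rw [hd i hi]
    have e : γ i * (c * (1 / γ i)) ^ 2 = c ^ 2 * (1 / γ i) * (γ i * (1 / γ i)) := by ring
    rw [e, mul_one_div_cancel hne, mul_one]

/-- The same on the negative edges, written with the positive quantities `−1/γᵢ`, `−γᵢ`: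
`Σ_{γ<0} dᵢ = −c·Σ_{γ<0}(−1/γᵢ)`, `Σ_{γ<0} γᵢdᵢ² = −c²·Σ_{γ<0}(−1/γᵢ)`. [folklore] -/
private theorem sums_of_negCurrents {d : Fin (m + 1) → ℝ} {c : ℝ}
    (hcur : ∀ i, γ i < 0 → γ i * d i = c) :
    ∑ i ∈ univ.filter (fun i => γ i < 0), d i
        = -(c * ∑ i ∈ univ.filter (fun i => γ i < 0), -(1 / γ i))
      ∧ ∑ i ∈ univ.filter (fun i => γ i < 0), γ i * d i ^ 2
          = -(c ^ 2 * ∑ i ∈ univ.filter (fun i => γ i < 0), -(1 / γ i)) := by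
  have hd : ∀ i ∈ univ.filter (fun i => γ i < 0), d i = c * (1 / γ i) := by
    intro i hi
    have hne : γ i ≠ 0 := (Finset.mem_filter.1 hi).2.ne
    rw [← hcur i (Finset.mem_filter.1 hi).2]
    have e : γ i * d i * (1 / γ i) = d i * (γ i * (1 / γ i)) := by ring
    rw [e, mul_one_div_cancel hne, mul_one]
  constructor
  · rw [Finset.mul_sum, ← Finset.sum_neg_distrib]
    exact Finset.sum_congr rfl fun i hi => by rw [hd i hi]; ring
  · rw [Finset.mul_sum, ← Finset.sum_neg_distrib]
    refine Finset.sum_congr rfl fun i hi => ?_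
    have hne : γ i ≠ 0 := (Finset.mem_filter.1 hi).2.ne
    rw [hd i hi]
    have e : γ i * (c * (1 / γ i)) ^ 2 = c ^ 2 * (1 / γ i) * (γ i * (1 / γ i)) := by ring
    rw [e, mul_one_div_cancel hne]
    ring

/-- **(A1) `𝒵 = −Σ1/γᵢ < 0`: equal positive currents make the form negative.** If the currents
`γᵢdᵢ` agree on all positive edges, `Σdᵢ = 0` and `Σᵢ 1/γᵢ > 0`, then `Σγᵢdᵢ² < 0` unless
`d = 0` (Cauchy–Schwarz on the negative edges). [cite: BronskiDeVilleFerguson2016, §2.2 Theorem 2.6 with §3.2 («`Z_G = −Σᵢ 1/γᵢ`», ring graph) (arXiv:1508.01507 p0005 L116–L140, p0007–p0008 §3.2)] -/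
theorem form_neg_or_zero_of_posCurrents (hγ : ∀ i, γ i ≠ 0) {d : Fin (m + 1) → ℝ}
    (htel : ∑ i, d i = 0) {c : ℝ} (hcur : ∀ i, 0 < γ i → γ i * d i = c)
    (hS : 0 < ∑ i, 1 / γ i) :
    ∑ i, γ i * d i ^ 2 < 0 ∨ ∀ i, d i = 0 := by
  classical
  obtain ⟨hPd, hPq⟩ := sums_of_posCurrents hcur
  set P := ∑ i ∈ univ.filter (fun i => 0 < γ i), 1 / γ i with hP
  set M := ∑ i ∈ univ.filter (fun i => γ i < 0), -(1 / γ i) with hM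
  set A := ∑ i ∈ univ.filter (fun i => γ i < 0), -γ i * d i ^ 2 with hA
  have hPM : ∑ i, 1 / γ i = P - M := by
    rw [sum_eq_sum_pos_add_sum_neg hγ (fun i => 1 / γ i), hM, Finset.sum_neg_distrib]; ring
  have hM0 : 0 ≤ M := Finset.sum_nonneg fun i hi =>
    neg_nonneg.2 (one_div_neg.2 (Finset.mem_filter.1 hi).2).le
  have hP0 : 0 ≤ P := Finset.sum_nonneg fun i hi => (one_div_pos.2 (Finset.mem_filter.1 hi).2).le
  have hA0 : 0 ≤ A := Finset.sum_nonneg fun i hi =>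
    mul_nonneg (neg_nonneg.2 (Finset.mem_filter.1 hi).2.le) (sq_nonneg _)
  have hMP : M < P := by linarith [hPM ▸ hS]
  have hNq : ∑ i ∈ univ.filter (fun i => γ i < 0), γ i * d i ^ 2 = -A := by
    rw [hA, ← Finset.sum_neg_distrib]
    exact Finset.sum_congr rfl fun i _ => by ring
  have hNd : ∑ i ∈ univ.filter (fun i => γ i < 0), d i = -(c * P) := by
    have h := sum_eq_sum_pos_add_sum_neg hγ d
    rw [htel, hPd] at h
    linarith
  have hCS := sq_sum_le_neg γ d
  rw [hNd] at hCS
  have hQ : ∑ i, γ i * d i ^ 2 = c ^ 2 * P - A := by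
    rw [sum_eq_sum_pos_add_sum_neg hγ (fun i => γ i * d i ^ 2), hPq, hNq]; ring
  by_cases hall : ∀ i, d i = 0
  · exact Or.inr hall
  left
  rw [hQ]
  push Not at hall
  obtain ⟨i₁, hi₁⟩ := hall
  by_cases hc : c = 0
  · -- all positive differences vanish, so a negative one does not: `A > 0`
    have hneg₁ : γ i₁ < 0 := by
      rcases (lt_or_gt_of_ne (hγ i₁)).symm with h | h
      · exfalso
        have := hcur i₁ h
        rw [hc] at this
        rcases mul_eq_zero.1 this with h' | h'
        · exact (hγ i₁) h'
        · exact hi₁ h'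
      · exact h
    have hApos : 0 < A := by
      rw [hA]
      refine Finset.sum_pos' (fun i hi =>
        mul_nonneg (neg_nonneg.2 (Finset.mem_filter.1 hi).2.le) (sq_nonneg _))
        ⟨i₁, Finset.mem_filter.2 ⟨Finset.mem_univ _, hneg₁⟩, ?_⟩
      have h1 : 0 < -γ i₁ := neg_pos.2 hneg₁
      have h2 : 0 < d i₁ ^ 2 := by positivity
      exact mul_pos h1 h2
    rw [hc]
    linarith
  · have hc2 : 0 < c ^ 2 := by positivity
    have hPpos : 0 < P := lt_of_le_of_lt hM0 hMP
    by_contra hQ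
    rw [not_lt] at hQ
    have h1 : M * A ≤ M * (c ^ 2 * P) := mul_le_mul_of_nonneg_left (by linarith) hM0
    have h2 : 0 < c ^ 2 * P * (P - M) := mul_pos (mul_pos hc2 hPpos) (sub_pos.2 hMP)
    nlinarith

/-- **(A2) `𝒵 = −Σ1/γᵢ > 0`: equal negative currents make the form positive.** If the currents
agree on all negative edges, `Σdᵢ = 0` and `Σᵢ 1/γᵢ < 0`, then `Σγᵢdᵢ² > 0` unless `d = 0`.
[cite: BronskiDeVilleFerguson2016, §2.2 Theorem 2.6 with §3.2 (arXiv:1508.01507 p0005 L116–L140, p0007–p0008 §3.2)] -/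
theorem form_pos_or_zero_of_negCurrents (hγ : ∀ i, γ i ≠ 0) {d : Fin (m + 1) → ℝ}
    (htel : ∑ i, d i = 0) {c : ℝ} (hcur : ∀ i, γ i < 0 → γ i * d i = c)
    (hS : ∑ i, 1 / γ i < 0) :
    0 < ∑ i, γ i * d i ^ 2 ∨ ∀ i, d i = 0 := by
  classical
  obtain ⟨hNd, hNq⟩ := sums_of_negCurrents hcur
  set P := ∑ i ∈ univ.filter (fun i => 0 < γ i), 1 / γ i with hP
  set M := ∑ i ∈ univ.filter (fun i => γ i < 0), -(1 / γ i) with hM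
  set B := ∑ i ∈ univ.filter (fun i => 0 < γ i), γ i * d i ^ 2 with hB
  have hPM : ∑ i, 1 / γ i = P - M := by
    rw [sum_eq_sum_pos_add_sum_neg hγ (fun i => 1 / γ i), hM, Finset.sum_neg_distrib]; ring
  have hM0 : 0 ≤ M := Finset.sum_nonneg fun i hi =>
    neg_nonneg.2 (one_div_neg.2 (Finset.mem_filter.1 hi).2).le
  have hP0 : 0 ≤ P := Finset.sum_nonneg fun i hi => (one_div_pos.2 (Finset.mem_filter.1 hi).2).le
  have hB0 : 0 ≤ B := Finset.sum_nonneg fun i hi =>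
    mul_nonneg (Finset.mem_filter.1 hi).2.le (sq_nonneg _)
  have hPM' : P < M := by linarith [hPM ▸ hS]
  have hPd : ∑ i ∈ univ.filter (fun i => 0 < γ i), d i = c * M := by
    have h := sum_eq_sum_pos_add_sum_neg hγ d
    rw [htel, hNd] at h
    linarith
  have hCS := sq_sum_le_pos γ d
  rw [hPd] at hCS
  have hQ : ∑ i, γ i * d i ^ 2 = B - c ^ 2 * M := by
    rw [sum_eq_sum_pos_add_sum_neg hγ (fun i => γ i * d i ^ 2), hNq]; ring
  by_cases hall : ∀ i, d i = 0
  · exact Or.inr hall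
  left
  rw [hQ]
  push Not at hall
  obtain ⟨i₁, hi₁⟩ := hall
  by_cases hc : c = 0
  · have hpos₁ : 0 < γ i₁ := by
      rcases (lt_or_gt_of_ne (hγ i₁)).symm with h | h
      · exact h
      · exfalso
        have := hcur i₁ h
        rw [hc] at this
        rcases mul_eq_zero.1 this with h' | h'
        · exact (hγ i₁) h'
        · exact hi₁ h'
    have hBpos : 0 < B := by
      rw [hB]
      refine Finset.sum_pos' (fun i hi => mul_nonneg (Finset.mem_filter.1 hi).2.le (sq_nonneg _))
        ⟨i₁, Finset.mem_filter.2 ⟨Finset.mem_univ _, hpos₁⟩, ?_⟩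
      have h2 : 0 < d i₁ ^ 2 := by positivity
      exact mul_pos hpos₁ h2
    rw [hc]
    linarith
  · have hc2 : 0 < c ^ 2 := by positivity
    have hMpos : 0 < M := lt_of_le_of_lt hP0 hPM'
    by_contra hQ'
    rw [not_lt] at hQ'
    have h1 : P * B ≤ P * (c ^ 2 * M) := mul_le_mul_of_nonneg_left (by linarith) hP0
    have h2 : 0 < c ^ 2 * M * (M - P) := mul_pos (mul_pos hc2 hMpos) (sub_pos.2 hPM')
    nlinarith

/-- **(A3)** With equal positive currents and `Σᵢ 1/γᵢ ≥ 0` the form is `≤ 0`. [folklore] -/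
private theorem form_nonpos_of_posCurrents (hγ : ∀ i, γ i ≠ 0) {d : Fin (m + 1) → ℝ}
    (htel : ∑ i, d i = 0) {c : ℝ} (hcur : ∀ i, 0 < γ i → γ i * d i = c)
    (hS : 0 ≤ ∑ i, 1 / γ i) : ∑ i, γ i * d i ^ 2 ≤ 0 := by
  classical
  obtain ⟨hPd, hPq⟩ := sums_of_posCurrents hcur
  set P := ∑ i ∈ univ.filter (fun i => 0 < γ i), 1 / γ i with hP
  set M := ∑ i ∈ univ.filter (fun i => γ i < 0), -(1 / γ i) with hM
  set A := ∑ i ∈ univ.filter (fun i => γ i < 0), -γ i * d i ^ 2 with hA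
  have hPM : ∑ i, 1 / γ i = P - M := by
    rw [sum_eq_sum_pos_add_sum_neg hγ (fun i => 1 / γ i), hM, Finset.sum_neg_distrib]; ring
  have hM0 : 0 ≤ M := Finset.sum_nonneg fun i hi =>
    neg_nonneg.2 (one_div_neg.2 (Finset.mem_filter.1 hi).2).le
  have hA0 : 0 ≤ A := Finset.sum_nonneg fun i hi =>
    mul_nonneg (neg_nonneg.2 (Finset.mem_filter.1 hi).2.le) (sq_nonneg _)
  have hMP : M ≤ P := by linarith [hPM ▸ hS]
  have hNq : ∑ i ∈ univ.filter (fun i => γ i < 0), γ i * d i ^ 2 = -A := by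
    rw [hA, ← Finset.sum_neg_distrib]
    exact Finset.sum_congr rfl fun i _ => by ring
  have hNd : ∑ i ∈ univ.filter (fun i => γ i < 0), d i = -(c * P) := by
    have h := sum_eq_sum_pos_add_sum_neg hγ d
    rw [htel, hPd] at h
    linarith
  have hCS := sq_sum_le_neg γ d
  rw [hNd] at hCS
  have hQ : ∑ i, γ i * d i ^ 2 = c ^ 2 * P - A := by
    rw [sum_eq_sum_pos_add_sum_neg hγ (fun i => γ i * d i ^ 2), hPq, hNq]; ring
  rw [hQ]
  -- `c²P² ≤ MA ≤ PA`, so `c²P ≤ A` when `P > 0`; when `P = 0` trivially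
  have hP0 : 0 ≤ P := Finset.sum_nonneg fun i hi => (one_div_pos.2 (Finset.mem_filter.1 hi).2).le
  rcases hP0.lt_or_eq with hPpos | hPz
  · have h1 : M * A ≤ P * A := mul_le_mul_of_nonneg_right hMP hA0
    nlinarith
  · rw [← hPz, mul_zero, zero_sub, neg_nonpos]
    exact hA0

/-- **(A4)** With equal negative currents and `Σᵢ 1/γᵢ ≤ 0` the form is `≥ 0`. [folklore] -/
private theorem form_nonneg_of_negCurrents (hγ : ∀ i, γ i ≠ 0) {d : Fin (m + 1) → ℝ}
    (htel : ∑ i, d i = 0) {c : ℝ} (hcur : ∀ i, γ i < 0 → γ i * d i = c)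
    (hS : ∑ i, 1 / γ i ≤ 0) : 0 ≤ ∑ i, γ i * d i ^ 2 := by
  classical
  obtain ⟨hNd, hNq⟩ := sums_of_negCurrents hcur
  set P := ∑ i ∈ univ.filter (fun i => 0 < γ i), 1 / γ i with hP
  set M := ∑ i ∈ univ.filter (fun i => γ i < 0), -(1 / γ i) with hM
  set B := ∑ i ∈ univ.filter (fun i => 0 < γ i), γ i * d i ^ 2 with hB
  have hPM : ∑ i, 1 / γ i = P - M := by
    rw [sum_eq_sum_pos_add_sum_neg hγ (fun i => 1 / γ i), hM, Finset.sum_neg_distrib]; ring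
  have hP0 : 0 ≤ P := Finset.sum_nonneg fun i hi => (one_div_pos.2 (Finset.mem_filter.1 hi).2).le
  have hB0 : 0 ≤ B := Finset.sum_nonneg fun i hi =>
    mul_nonneg (Finset.mem_filter.1 hi).2.le (sq_nonneg _)
  have hPM' : P ≤ M := by linarith [hPM ▸ hS]
  have hPd : ∑ i ∈ univ.filter (fun i => 0 < γ i), d i = c * M := by
    have h := sum_eq_sum_pos_add_sum_neg hγ d
    rw [htel, hNd] at h
    linarith
  have hCS := sq_sum_le_pos γ d
  rw [hPd] at hCS
  have hQ : ∑ i, γ i * d i ^ 2 = B - c ^ 2 * M := by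
    rw [sum_eq_sum_pos_add_sum_neg hγ (fun i => γ i * d i ^ 2), hNq]; ring
  rw [hQ]
  have hM0 : 0 ≤ M := Finset.sum_nonneg fun i hi =>
    neg_nonneg.2 (one_div_neg.2 (Finset.mem_filter.1 hi).2).le
  rcases hM0.lt_or_eq with hMpos | hMz
  · have h1 : P * B ≤ M * B := mul_le_mul_of_nonneg_right hPM' hB0
    nlinarith
  · rw [← hMz, mul_zero, sub_zero]
    exact hB0

/-- If `Σᵢ 1/γᵢ ≥ 0` some edge is positive. [folklore] -/
private theorem exists_pos_of_sum_inv_nonneg (hγ : ∀ i, γ i ≠ 0) (hS : 0 ≤ ∑ i, 1 / γ i) :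
    ∃ i, 0 < γ i := by
  by_contra h
  push Not at h
  have : ∑ i, 1 / γ i < 0 :=
    Finset.sum_neg (fun i _ => one_div_neg.2 ((h i).lt_of_ne (hγ i))) Finset.univ_nonempty
  linarith

/-- If `Σᵢ 1/γᵢ ≤ 0` some edge is negative. [folklore] -/
private theorem exists_neg_of_sum_inv_nonpos (hγ : ∀ i, γ i ≠ 0) (hS : ∑ i, 1 / γ i ≤ 0) :
    ∃ i, γ i < 0 := by
  by_contra h
  push Not at h
  have : 0 < ∑ i, 1 / γ i :=
    Finset.sum_pos (fun i _ => one_div_pos.2 ((h i).lt_of_ne' (hγ i))) Finset.univ_nonempty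
  linarith

end Currents

/-! ### §4. The four remaining counts (equal currents with a grounded node / without) -/

section Counts2

variable {γ : Fin (m + 1) → ℝ} {H : Matrix (Fin (m + 1)) (Fin (m + 1)) ℝ}

/-- **(K1)** `Σᵢ 1/γᵢ > 0`: `#{λ ≥ 0} ≤ #{γ > 0}` (equal positive currents and a grounded node give
a negative definite form). [folklore] -/
private theorem card_nonneg_le_card_pos (hγ : ∀ i, γ i ≠ 0) (hH : H.IsHermitian)
    (hform : ∀ x : Fin (m + 1) → ℝ, x ⬝ᵥ H *ᵥ x = ∑ i, γ i * (x (finRotate (m + 1) i) - x i) ^ 2)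
    (hS : 0 < ∑ i, 1 / γ i) :
    (univ.filter fun k => 0 ≤ hH.eigenvalues k).card ≤ (univ.filter fun i => 0 < γ i).card := by
  classical
  set Pos := univ.filter fun i => 0 < γ i with hPos
  obtain ⟨i₀, hi₀⟩ := exists_pos_of_sum_inv_nonneg hγ hS.le
  have hi₀mem : i₀ ∈ Pos := Finset.mem_filter.2 ⟨Finset.mem_univ _, hi₀⟩
  let D : Fin (m + 1) → ((Fin (m + 1) → ℝ) →ₗ[ℝ] ℝ) := fun i =>
    LinearMap.proj (R := ℝ) (φ := fun _ : Fin (m + 1) => ℝ) (finRotate (m + 1) i)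
      - LinearMap.proj (R := ℝ) (φ := fun _ : Fin (m + 1) => ℝ) i
  let C : Fin (m + 1) → ((Fin (m + 1) → ℝ) →ₗ[ℝ] ℝ) := fun i => γ i • D i - γ i₀ • D i₀
  let L : (Fin (m + 1) → ℝ) →ₗ[ℝ] ((↥(Pos.erase i₀) → ℝ) × ℝ) :=
    (LinearMap.pi fun i : ↥(Pos.erase i₀) => C i.1).prod
      (LinearMap.proj (R := ℝ) (φ := fun _ : Fin (m + 1) => ℝ) 0)
  refine NonuniformKuramoto.card_eigenvalues_nonneg_le_of_neg_on_ker hH L ?_ fun x hx0 hx => ?_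
  · rw [Module.finrank_prod, Module.finrank_fintype_fun_eq_card, Fintype.card_coe,
      Module.finrank_self, Finset.card_erase_of_mem hi₀mem]
    have := Finset.card_pos.2 ⟨i₀, hi₀mem⟩
    omega
  · rw [LinearMap.prod_apply, Prod.mk_eq_zero] at hx
    have hcur : ∀ i, 0 < γ i → γ i * (x (finRotate (m + 1) i) - x i)
        = γ i₀ * (x (finRotate (m + 1) i₀) - x i₀) := by
      intro i hi
      by_cases hii : i = i₀
      · rw [hii]
      · have h := congrFun hx.1 ⟨i, Finset.mem_erase.2 ⟨hii, Finset.mem_filter.2 ⟨Finset.mem_univ _, hi⟩⟩⟩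
        have h' : γ i * (x (finRotate (m + 1) i) - x i)
            - γ i₀ * (x (finRotate (m + 1) i₀) - x i₀) = 0 := by
          simpa [C, D] using h
        linarith
    rcases form_neg_or_zero_of_posCurrents hγ (sum_diff_eq_zero x) hcur hS with h | h
    · rw [hform]; exact h
    · exact absurd (eq_zero_of_diff_eq_zero h hx.2) hx0

/-- **(K3)** `Σᵢ 1/γᵢ < 0`: `#{λ ≤ 0} ≤ #{γ < 0}`. [folklore] -/
private theorem card_nonpos_le_card_neg (hγ : ∀ i, γ i ≠ 0) (hH : H.IsHermitian)
    (hform : ∀ x : Fin (m + 1) → ℝ, x ⬝ᵥ H *ᵥ x = ∑ i, γ i * (x (finRotate (m + 1) i) - x i) ^ 2)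
    (hS : ∑ i, 1 / γ i < 0) :
    (univ.filter fun k => hH.eigenvalues k ≤ 0).card ≤ (univ.filter fun i => γ i < 0).card := by
  classical
  set Neg := univ.filter fun i => γ i < 0 with hNeg
  obtain ⟨i₀, hi₀⟩ := exists_neg_of_sum_inv_nonpos hγ hS.le
  have hi₀mem : i₀ ∈ Neg := Finset.mem_filter.2 ⟨Finset.mem_univ _, hi₀⟩
  let D : Fin (m + 1) → ((Fin (m + 1) → ℝ) →ₗ[ℝ] ℝ) := fun i =>
    LinearMap.proj (R := ℝ) (φ := fun _ : Fin (m + 1) => ℝ) (finRotate (m + 1) i)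
      - LinearMap.proj (R := ℝ) (φ := fun _ : Fin (m + 1) => ℝ) i
  let C : Fin (m + 1) → ((Fin (m + 1) → ℝ) →ₗ[ℝ] ℝ) := fun i => γ i • D i - γ i₀ • D i₀
  let L : (Fin (m + 1) → ℝ) →ₗ[ℝ] ((↥(Neg.erase i₀) → ℝ) × ℝ) :=
    (LinearMap.pi fun i : ↥(Neg.erase i₀) => C i.1).prod
      (LinearMap.proj (R := ℝ) (φ := fun _ : Fin (m + 1) => ℝ) 0)
  refine NonuniformKuramoto.card_eigenvalues_nonpos_le_of_pos_on_ker hH L ?_ fun x hx0 hx => ?_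
  · rw [Module.finrank_prod, Module.finrank_fintype_fun_eq_card, Fintype.card_coe,
      Module.finrank_self, Finset.card_erase_of_mem hi₀mem]
    have := Finset.card_pos.2 ⟨i₀, hi₀mem⟩
    omega
  · rw [LinearMap.prod_apply, Prod.mk_eq_zero] at hx
    have hcur : ∀ i, γ i < 0 → γ i * (x (finRotate (m + 1) i) - x i)
        = γ i₀ * (x (finRotate (m + 1) i₀) - x i₀) := by
      intro i hi
      by_cases hii : i = i₀
      · rw [hii]
      · have h := congrFun hx.1 ⟨i, Finset.mem_erase.2 ⟨hii, Finset.mem_filter.2 ⟨Finset.mem_univ _, hi⟩⟩⟩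
        have h' : γ i * (x (finRotate (m + 1) i) - x i)
            - γ i₀ * (x (finRotate (m + 1) i₀) - x i₀) = 0 := by
          simpa [C, D] using h
        linarith
    rcases form_pos_or_zero_of_negCurrents hγ (sum_diff_eq_zero x) hcur hS with h | h
    · rw [hform]; exact h
    · exact absurd (eq_zero_of_diff_eq_zero h hx.2) hx0

/-- **(K6)** `Σᵢ 1/γᵢ ≥ 0`: `#{λ > 0} ≤ #{γ > 0} − 1` (equal positive currents alone give a form
`≤ 0`). [folklore] -/
private theorem card_pos_le_card_pos_pred (hγ : ∀ i, γ i ≠ 0) (hH : H.IsHermitian)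
    (hform : ∀ x : Fin (m + 1) → ℝ, x ⬝ᵥ H *ᵥ x = ∑ i, γ i * (x (finRotate (m + 1) i) - x i) ^ 2)
    (hS : 0 ≤ ∑ i, 1 / γ i) :
    (univ.filter fun k => 0 < hH.eigenvalues k).card ≤ (univ.filter fun i => 0 < γ i).card - 1 := by
  classical
  set Pos := univ.filter fun i => 0 < γ i with hPos
  obtain ⟨i₀, hi₀⟩ := exists_pos_of_sum_inv_nonneg hγ hS
  have hi₀mem : i₀ ∈ Pos := Finset.mem_filter.2 ⟨Finset.mem_univ _, hi₀⟩
  let D : Fin (m + 1) → ((Fin (m + 1) → ℝ) →ₗ[ℝ] ℝ) := fun i =>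
    LinearMap.proj (R := ℝ) (φ := fun _ : Fin (m + 1) => ℝ) (finRotate (m + 1) i)
      - LinearMap.proj (R := ℝ) (φ := fun _ : Fin (m + 1) => ℝ) i
  let C : Fin (m + 1) → ((Fin (m + 1) → ℝ) →ₗ[ℝ] ℝ) := fun i => γ i • D i - γ i₀ • D i₀
  let L : (Fin (m + 1) → ℝ) →ₗ[ℝ] (↥(Pos.erase i₀) → ℝ) :=
    LinearMap.pi fun i : ↥(Pos.erase i₀) => C i.1
  refine NonuniformKuramoto.card_eigenvalues_pos_le_of_nonpos_on_ker hH L ?_ fun x hx => ?_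
  · rw [Module.finrank_fintype_fun_eq_card, Fintype.card_coe, Finset.card_erase_of_mem hi₀mem]
  · have hcur : ∀ i, 0 < γ i → γ i * (x (finRotate (m + 1) i) - x i)
        = γ i₀ * (x (finRotate (m + 1) i₀) - x i₀) := by
      intro i hi
      by_cases hii : i = i₀
      · rw [hii]
      · have h := congrFun hx ⟨i, Finset.mem_erase.2 ⟨hii, Finset.mem_filter.2 ⟨Finset.mem_univ _, hi⟩⟩⟩
        have h' : γ i * (x (finRotate (m + 1) i) - x i)
            - γ i₀ * (x (finRotate (m + 1) i₀) - x i₀) = 0 := by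
          simpa [L, C, D] using h
        linarith
    rw [hform]
    exact form_nonpos_of_posCurrents hγ (sum_diff_eq_zero x) hcur hS

/-- **(K5)** `Σᵢ 1/γᵢ ≤ 0`: `#{λ < 0} ≤ #{γ < 0} − 1`. [folklore] -/
private theorem card_neg_le_card_neg_pred (hγ : ∀ i, γ i ≠ 0) (hH : H.IsHermitian)
    (hform : ∀ x : Fin (m + 1) → ℝ, x ⬝ᵥ H *ᵥ x = ∑ i, γ i * (x (finRotate (m + 1) i) - x i) ^ 2)
    (hS : ∑ i, 1 / γ i ≤ 0) :
    (univ.filter fun k => hH.eigenvalues k < 0).card ≤ (univ.filter fun i => γ i < 0).card - 1 := by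
  classical
  set Neg := univ.filter fun i => γ i < 0 with hNeg
  obtain ⟨i₀, hi₀⟩ := exists_neg_of_sum_inv_nonpos hγ hS
  have hi₀mem : i₀ ∈ Neg := Finset.mem_filter.2 ⟨Finset.mem_univ _, hi₀⟩
  let D : Fin (m + 1) → ((Fin (m + 1) → ℝ) →ₗ[ℝ] ℝ) := fun i =>
    LinearMap.proj (R := ℝ) (φ := fun _ : Fin (m + 1) => ℝ) (finRotate (m + 1) i)
      - LinearMap.proj (R := ℝ) (φ := fun _ : Fin (m + 1) => ℝ) i
  let C : Fin (m + 1) → ((Fin (m + 1) → ℝ) →ₗ[ℝ] ℝ) := fun i => γ i • D i - γ i₀ • D i₀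
  let L : (Fin (m + 1) → ℝ) →ₗ[ℝ] (↥(Neg.erase i₀) → ℝ) :=
    LinearMap.pi fun i : ↥(Neg.erase i₀) => C i.1
  refine NonuniformKuramoto.card_eigenvalues_neg_le_of_nonneg_on_ker hH L ?_ fun x hx => ?_
  · rw [Module.finrank_fintype_fun_eq_card, Fintype.card_coe, Finset.card_erase_of_mem hi₀mem]
  · have hcur : ∀ i, γ i < 0 → γ i * (x (finRotate (m + 1) i) - x i)
        = γ i₀ * (x (finRotate (m + 1) i₀) - x i₀) := by
      intro i hi
      by_cases hii : i = i₀
      · rw [hii]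
      · have h := congrFun hx ⟨i, Finset.mem_erase.2 ⟨hii, Finset.mem_filter.2 ⟨Finset.mem_univ _, hi⟩⟩⟩
        have h' : γ i * (x (finRotate (m + 1) i) - x i)
            - γ i₀ * (x (finRotate (m + 1) i₀) - x i₀) = 0 := by
          simpa [L, C, D] using h
        linarith
    rw [hform]
    exact form_nonneg_of_negCurrents hγ (sum_diff_eq_zero x) hcur hS

end Counts2

/-! ### §5. BRONSKI–DeVILLE–FERGUSON THEOREM 2.6 ON THE RING: the inertia of a signed cycle -/

section Inertia

variable {γ : Fin (m + 1) → ℝ} {H : Matrix (Fin (m + 1)) (Fin (m + 1)) ℝ}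

/-- The three eigenvalue counts add up to `m + 1`. [folklore] -/
private theorem card_neg_add_card_zero_add_card_pos (hH : H.IsHermitian) :
    (univ.filter fun i => hH.eigenvalues i < 0).card
      + (univ.filter fun i => hH.eigenvalues i = 0).card
      + (univ.filter fun i => 0 < hH.eigenvalues i).card = m + 1 := by
  rw [← Finset.card_union_of_disjoint, ← Finset.card_union_of_disjoint]
  · conv_rhs => rw [← Fintype.card_fin (m + 1), ← Finset.card_univ]
    congr 1
    ext i
    simp only [Finset.mem_union, Finset.mem_filter, Finset.mem_univ, true_and, iff_true]
    rcases lt_trichotomy (hH.eigenvalues i) 0 with h | h | h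
    · exact Or.inl (Or.inl h)
    · exact Or.inl (Or.inr h)
    · exact Or.inr h
  · rw [Finset.disjoint_left]
    intro i h1 h2
    simp only [Finset.mem_union, Finset.mem_filter, Finset.mem_univ, true_and] at h1 h2
    rcases h1 with h1 | h1 <;> linarith
  · rw [Finset.disjoint_left]
    intro i h1 h2
    simp only [Finset.mem_filter, Finset.mem_univ, true_and] at h1 h2
    linarith

/-- `#{λ ≤ 0} = n₋ + n₀`. [folklore] -/
private theorem card_nonpos_eq (hH : H.IsHermitian) :
    (univ.filter fun i => hH.eigenvalues i ≤ 0).card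
      = (univ.filter fun i => hH.eigenvalues i < 0).card
        + (univ.filter fun i => hH.eigenvalues i = 0).card := by
  rw [← Finset.card_union_of_disjoint]
  · congr 1
    ext i
    simp only [Finset.mem_union, Finset.mem_filter, Finset.mem_univ, true_and]
    constructor
    · intro h
      rcases h.lt_or_eq with h | h
      · exact Or.inl h
      · exact Or.inr h
    · rintro (h | h)
      · exact h.le
      · exact h.le
  · rw [Finset.disjoint_left]
    intro i h1 h2
    simp only [Finset.mem_filter, Finset.mem_univ, true_and] at h1 h2
    linarith

/-- `#{λ ≥ 0} = n₀ + n₊`. [folklore] -/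
private theorem card_nonneg_eq (hH : H.IsHermitian) :
    (univ.filter fun i => 0 ≤ hH.eigenvalues i).card
      = (univ.filter fun i => hH.eigenvalues i = 0).card
        + (univ.filter fun i => 0 < hH.eigenvalues i).card := by
  rw [← Finset.card_union_of_disjoint]
  · congr 1
    ext i
    simp only [Finset.mem_union, Finset.mem_filter, Finset.mem_univ, true_and]
    constructor
    · intro h
      rcases h.lt_or_eq with h | h
      · exact Or.inr h
      · exact Or.inl h.symm
    · rintro (h | h)
      · exact h.ge
      · exact h.le
  · rw [Finset.disjoint_left]
    intro i h1 h2
    simp only [Finset.mem_filter, Finset.mem_univ, true_and] at h1 h2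
    linarith

/-- ★★★ **BRONSKI–DeVILLE–FERGUSON THEOREM 2.6 FOR THE RING, case `Σᵢ 1/γᵢ > 0`** («the number of
positive eigenvalues of the Laplacian is the number of negative edges in the graph minus the number
of positive eigenvalues of the cycle intersection matrix», `n₊(ℒ_G) = #{e : γₑ < 0} − n₊(𝒵_G)`, and
for the ring `R_N` «`Z_G` is the `1 × 1` matrix (i.e. the scalar) `Z_G = −Σᵢ 1/γᵢ`»): on the cycle
with `N = m + 1` edges `(i, ρi)`, `ρ = finRotate (m+1)`, non-zero weights `γᵢ` of which `j` are
negative, if `Σᵢ 1/γᵢ > 0` (`𝒵 < 0`) then every real symmetric `H` carrying the form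
`Σᵢ γᵢ(x_{ρi} − xᵢ)²` (`H = −ℒ_G`, the Hessian sign) has EXACTLY `j` negative eigenvalues, a SIMPLE
zero, and `m − j` positive ones — `n₊(ℒ_G) = j`. [cite: BronskiDeVilleFerguson2016, §2.2 Theorem 2.6 and §3.2 One-cycle graphs («`Z_G = −Σᵢ 1/γᵢ`») (arXiv:1508.01507 p0005 L116–L140, p0007 §3.2 – p0008 L1–L20)] -/
theorem inertia_of_sum_inv_pos (hγ : ∀ i, γ i ≠ 0) (hH : H.IsHermitian)
    (hform : ∀ x : Fin (m + 1) → ℝ, x ⬝ᵥ H *ᵥ x = ∑ i, γ i * (x (finRotate (m + 1) i) - x i) ^ 2)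
    (hS : 0 < ∑ i, 1 / γ i) :
    (univ.filter fun k => hH.eigenvalues k < 0).card = (univ.filter fun i => γ i < 0).card
      ∧ (univ.filter fun k => hH.eigenvalues k = 0).card = 1
      ∧ (univ.filter fun k => 0 < hH.eigenvalues k).card
          = m - (univ.filter fun i => γ i < 0).card := by
  classical
  have k1 := card_nonneg_le_card_pos hγ hH hform hS
  have k2 := card_nonpos_le_card_neg_succ hγ hH hform
  obtain ⟨i, hi⟩ := exists_eigenvalues_eq_zero hH hform
  have hz : 1 ≤ (univ.filter fun k => hH.eigenvalues k = 0).card :=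
    Finset.card_pos.2 ⟨i, Finset.mem_filter.2 ⟨Finset.mem_univ _, hi⟩⟩
  have htot := card_neg_add_card_zero_add_card_pos hH
  have hpn := card_pos_add_card_neg hγ
  rw [card_nonneg_eq hH] at k1
  rw [card_nonpos_eq hH] at k2
  omega

/-- ★★★ **THEOREM 2.6 FOR THE RING, case `Σᵢ 1/γᵢ < 0`** (`𝒵 = −Σ1/γᵢ > 0`, `n₊(𝒵) = 1`): exactly
`j − 1` negative eigenvalues, a simple zero, and `m + 1 − j` positive ones — `n₊(ℒ_G) = j − 1`;
with one negative edge this is the STABLE side `Σᵢ 1/γᵢ < 0` of §3.2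
(«to obtain a stable Laplacian, we need that `Z_G > 0`, or `Σ 1/γᵢ < 0`»).
[cite: BronskiDeVilleFerguson2016, §2.2 Theorem 2.6 and §3.2 (arXiv:1508.01507 p0005 L116–L140, p0008 L1–L20)] -/
theorem inertia_of_sum_inv_neg (hγ : ∀ i, γ i ≠ 0) (hH : H.IsHermitian)
    (hform : ∀ x : Fin (m + 1) → ℝ, x ⬝ᵥ H *ᵥ x = ∑ i, γ i * (x (finRotate (m + 1) i) - x i) ^ 2)
    (hS : ∑ i, 1 / γ i < 0) :
    (univ.filter fun k => hH.eigenvalues k < 0).card = (univ.filter fun i => γ i < 0).card - 1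
      ∧ (univ.filter fun k => hH.eigenvalues k = 0).card = 1
      ∧ (univ.filter fun k => 0 < hH.eigenvalues k).card
          = m + 1 - (univ.filter fun i => γ i < 0).card := by
  classical
  have k3 := card_nonpos_le_card_neg hγ hH hform hS
  have k4 := card_nonneg_le_card_pos_succ hγ hH hform
  obtain ⟨i, hi⟩ := exists_eigenvalues_eq_zero hH hform
  have hz : 1 ≤ (univ.filter fun k => hH.eigenvalues k = 0).card :=
    Finset.card_pos.2 ⟨i, Finset.mem_filter.2 ⟨Finset.mem_univ _, hi⟩⟩
  have htot := card_neg_add_card_zero_add_card_pos hH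
  have hpn := card_pos_add_card_neg hγ
  rw [card_nonpos_eq hH] at k3
  rw [card_nonneg_eq hH] at k4
  omega

/-- ★★ **THE CROSSING `Σᵢ 1/γᵢ = 0`** (`𝒵 = 0`; by Theorem 2.8 of the source `detred ℒ = N·det 𝒵·Πγₑ
= 0`, a non-simple zero): exactly `j − 1` negative eigenvalues, a DOUBLE zero, `m − j` positive
ones (the second kernel vector has differences `x_{ρi} − xᵢ = 1/γᵢ`).
[cite: BronskiDeVilleFerguson2016, §2.1 Definition 2.2 («`detred(ℒ_G) = 0` iff `ℒ_G` has a nonsimple eigenvalue at `0`»), §2.2 Theorems 2.6 and 2.8, §3.2 (arXiv:1508.01507 p0005 L25–L34, L116–L140, p0006 L56–L76)] -/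
theorem inertia_of_sum_inv_eq_zero (hγ : ∀ i, γ i ≠ 0) (hH : H.IsHermitian)
    (hform : ∀ x : Fin (m + 1) → ℝ, x ⬝ᵥ H *ᵥ x = ∑ i, γ i * (x (finRotate (m + 1) i) - x i) ^ 2)
    (hS : ∑ i, 1 / γ i = 0) :
    (univ.filter fun k => hH.eigenvalues k < 0).card = (univ.filter fun i => γ i < 0).card - 1
      ∧ (univ.filter fun k => hH.eigenvalues k = 0).card = 2
      ∧ (univ.filter fun k => 0 < hH.eigenvalues k).card
          = m - (univ.filter fun i => γ i < 0).card := by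
  classical
  have k2 := card_nonpos_le_card_neg_succ hγ hH hform
  have k4 := card_nonneg_le_card_pos_succ hγ hH hform
  have k5 := card_neg_le_card_neg_pred hγ hH hform hS.le
  have k6 := card_pos_le_card_pos_pred hγ hH hform hS.ge
  obtain ⟨ip, hip⟩ := exists_pos_of_sum_inv_nonneg hγ hS.ge
  obtain ⟨iq, hiq⟩ := exists_neg_of_sum_inv_nonpos hγ hS.le
  have hp1 : 1 ≤ (univ.filter fun i => 0 < γ i).card :=
    Finset.card_pos.2 ⟨ip, Finset.mem_filter.2 ⟨Finset.mem_univ _, hip⟩⟩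
  have hq1 : 1 ≤ (univ.filter fun i => γ i < 0).card :=
    Finset.card_pos.2 ⟨iq, Finset.mem_filter.2 ⟨Finset.mem_univ _, hiq⟩⟩
  have htot := card_neg_add_card_zero_add_card_pos hH
  have hpn := card_pos_add_card_neg hγ
  rw [card_nonpos_eq hH] at k2
  rw [card_nonneg_eq hH] at k4
  omega

/-- At the crossing the vector of partial sums of `1/γᵢ` is a second, non-constant kernel direction
of the form: `x_{ρi} − xᵢ = 1/γᵢ` gives `Σγᵢ(x_{ρi} − xᵢ)² = Σ 1/γᵢ = 0` while some difference is
non-zero. Stated on the differences: any `d` with `γᵢdᵢ = 1` has `Σγᵢdᵢ² = Σ1/γᵢ` (the value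
of the cycle intersection form on the cycle, `−𝒵_G = Σₑ γₑ⁻¹`).
[cite: BronskiDeVilleFerguson2016, §2.1 Definition 2.4 (`(𝒵_G)ᵢⱼ = −Σₑ γₑ⁻¹ y_{i,e}y_{j,e}`) and §3.2 («`Z_G = −Σᵢ 1/γᵢ`») (arXiv:1508.01507 p0005 L64–L80, p0007 §3.2)] -/
theorem form_of_unit_currents {d : Fin (m + 1) → ℝ} (hcur : ∀ i, γ i * d i = 1) :
    ∑ i, γ i * d i ^ 2 = ∑ i, 1 / γ i := by
  refine Finset.sum_congr rfl fun i _ => ?_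
  have hne : γ i ≠ 0 := fun h => by have := hcur i; rw [h, zero_mul] at this; exact zero_ne_one this
  have hd : d i = 1 / γ i := by
    rw [eq_div_iff hne, mul_comm]; exact hcur i
  rw [hd]
  have e : γ i * (1 / γ i) ^ 2 = (1 / γ i) * (γ i * (1 / γ i)) := by ring
  rw [e, mul_one_div_cancel hne, mul_one]

end Inertia

/-! ### §6. Ring-supported couplings: the linearised form is the cycle form `Σᵢ γᵢ(x_{ρi} − xᵢ)²`
with `γᵢ = P_{i,ρi} cos(θᵢ − θ_{ρi})` -/

/-- On a ring-supported symmetric coupling (`m + 1 ≥ 3` nodes, lines `(i, ρ i)`) the linearised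
form is the signed cycle form indexed by the rotation:
`Σᵢ xᵢ Σⱼ Pᵢⱼcos(θᵢ − θⱼ)(xᵢ − xⱼ) = Σᵢ P_{i,ρi}cos(θᵢ − θ_{ρi})·(x_{ρi} − xᵢ)²`.
[cite: BronskiDeVilleFerguson2016, §2.1 Lemma 2.5 («`ℒ_G = −B_G D_G B_Gᵀ`», the form edge by edge) and §3.2 (ring `R_N`, «edge `i` goes from `i → i+1`, modulo `N`») (arXiv:1508.01507 p0005 L89–L112, p0007 §3.2)] -/
theorem ring_linForm_eq_sum_rotate (hm : 2 ≤ m) {P : Fin (m + 1) → Fin (m + 1) → ℝ}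
    (hP : ∀ i j, P i j = P j i)
    (hsupp : ∀ i j, P i j ≠ 0 → j = finRotate (m + 1) i ∨ i = finRotate (m + 1) j)
    (θ x : Fin (m + 1) → ℝ) :
    ∑ i, x i * ∑ j, P i j * Real.cos (θ i - θ j) * (x i - x j)
      = ∑ i, (P i (finRotate (m + 1) i) * Real.cos (θ i - θ (finRotate (m + 1) i)))
          * (x (finRotate (m + 1) i) - x i) ^ 2 := by
  rw [SignedCycle.ring_linForm_eq hm hP hsupp θ x, Fin.sum_univ_castSucc]
  simp only [finRotate_castSucc', finRotate_last]
  ring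

end SignedCycle

/-! ### §7. THE MODEL, first-order tier: a Kuramoto / droop RING with ANY number `j` of lines
loaded beyond `π/2` — type `j` or `j − 1` by the sign of `Σᵢ 1/(P_{i,ρi}cos(θᵢ − θ_{ρi}))` -/

namespace NonuniformKuramoto

open Literature.LinearAlgebra.Matrix (refMinor refMinor_isHermitian)

variable {m : ℕ} (Kur : NonuniformKuramoto (m + 1))

/-- The Hesse-convention stability matrix `L(θ)` of a ring network carries the cycle form.
[cite: BronskiDeVilleFerguson2016, §1.1 eq. (Kuramoto) and §2.1 Lemma 2.5 (arXiv:1508.01507 p0003 L82–L100, p0005 L89–L112)] -/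
theorem ring_lap_form (hm : 2 ≤ m) (hP : ∀ i j, Kur.P i j = Kur.P j i)
    (hsupp : ∀ i j, Kur.P i j ≠ 0 → j = finRotate (m + 1) i ∨ i = finRotate (m + 1) j)
    (θ x : Fin (m + 1) → ℝ) :
    x ⬝ᵥ Kur.toDroopNetwork.lap θ *ᵥ x
      = ∑ i, (Kur.P i (finRotate (m + 1) i) * Real.cos (θ i - θ (finRotate (m + 1) i))) * (x (finRotate (m + 1) i) - x i) ^ 2 := by
  rw [Kur.dotProduct_lap_mulVec]
  simp only [toDroopNetwork_linWeight]
  exact SignedCycle.ring_linForm_eq_sum_rotate hm hP hsupp θ x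

/-- ★★★ **A RING FIXED POINT WITH `j` INVERTED LINES AND `Σᵢ 1/γᵢ > 0` HAS TYPE EXACTLY `j`.**
MODEL: first-order (non-uniform) Kuramoto / droop oscillators on a ring of `m + 1 ≥ 3` nodes
(symmetric coupling supported on the ring lines `(i, ρi)`, `ρ = finRotate`), ANY natural frequencies,
ANY `Dᵢ > 0`; at a configuration `θ` with line weights `γᵢ = P_{i,ρi}cos(θᵢ − θ_{ρi}) ≠ 0`, `j` of
them negative (lines loaded beyond `π/2`), and `Σᵢ 1/γᵢ > 0`: the Jacobian `−D⁻¹L(θ)` has EXACTLY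
`j` characteristic roots in the open right half-plane, `m − j` in the open left half-plane and ONE on
the axis (Bronski–DeVille–Ferguson: `n₊(ℒ) = #{γₑ < 0} − n₊(−Σ1/γᵢ)`). In particular with `j ≥ 1`
such a fixed point is unstable, and with `j = 0` this is the all-short-lines sink.
[cite: BronskiDeVilleFerguson2016, §1.1 («the dimension of the unstable manifold to a fixed point … is given by the number of positive eigenvalues of a graph Laplacian»), §2.2 Theorem 2.6, §3.2 (arXiv:1508.01507 p0003 L82–L110, p0005 L116–L140, p0007–p0008 §3.2); Chiang1995, §6 Theorem 6.7 (R1)] -/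
theorem ring_type_auxJac_of_sum_inv_pos (hm : 2 ≤ m) (hD : ∀ i, 0 < Kur.D i)
    (hP : ∀ i j, Kur.P i j = Kur.P j i)
    (hsupp : ∀ i j, Kur.P i j ≠ 0 → j = finRotate (m + 1) i ∨ i = finRotate (m + 1) j)
    (θ : Fin (m + 1) → ℝ) (hnd : ∀ i, Kur.P i (finRotate (m + 1) i) * Real.cos (θ i - θ (finRotate (m + 1) i)) ≠ 0)
    (hS : 0 < ∑ i, 1 / (Kur.P i (finRotate (m + 1) i) * Real.cos (θ i - θ (finRotate (m + 1) i)))) :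
    ((Kur.toDroopNetwork.auxJac θ).map (algebraMap ℝ ℂ)).charpoly.roots.countP (fun μ => 0 < μ.re)
        = (univ.filter fun i => Kur.P i (finRotate (m + 1) i) * Real.cos (θ i - θ (finRotate (m + 1) i)) < 0).card
      ∧ ((Kur.toDroopNetwork.auxJac θ).map (algebraMap ℝ ℂ)).charpoly.roots.countP
          (fun μ => μ.re < 0) = m - (univ.filter fun i => Kur.P i (finRotate (m + 1) i) * Real.cos (θ i - θ (finRotate (m + 1) i)) < 0).card
      ∧ ((Kur.toDroopNetwork.auxJac θ).map (algebraMap ℝ ℂ)).charpoly.roots.countP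
          (fun μ => μ.re = 0) = 1 := by
  classical
  have hL : (Kur.toDroopNetwork.lap θ).IsHermitian :=
    DroopNetwork.lap_isHermitian (N := Kur.toDroopNetwork) (fun i j => hP i j) θ
  obtain ⟨h1, h2, h3⟩ := SignedCycle.inertia_of_sum_inv_pos hnd hL (Kur.ring_lap_form hm hP hsupp θ) hS
  have hrow : ∀ i, ∑ l, Kur.toDroopNetwork.lap θ i l = 0 :=
    fun i => DroopNetwork.sum_lap_row (N := Kur.toDroopNetwork) θ i
  have hHm := refMinor_isHermitian hL 0
  obtain ⟨r1, r2, -, hreg⟩ := RefNode.refMinor_counts hL hrow h2 0 hHm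
  obtain ⟨t1, t2, t3⟩ := Kur.countP_roots_charpoly_toDroopNetwork_auxJac hP hD θ 0 hHm hreg
  refine ⟨?_, ?_, t3⟩
  · rw [t1, r2, h1]
  · rw [t2, r1, h3]

/-- ★★★ **… AND WITH `Σᵢ 1/γᵢ < 0` IT HAS TYPE EXACTLY `j − 1`** (so with ONE inverted line the fixed
point is locally exponentially stable modulo rotation iff `Σᵢ 1/γᵢ < 0` — the effective-resistance
criterion of `RingLongLineResistanceCriterion.lean` — and with `j ≥ 2` inverted lines it is ALWAYS
unstable, of type `j − 1 ≥ 1` or `j`): exactly `j − 1` roots in the open right half-plane,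
`m + 1 − j` in the open left half-plane, one on the axis.
[cite: BronskiDeVilleFerguson2016, §2.2 Theorem 2.6, §3.2 («to obtain a stable Laplacian, we need that `Z_G > 0`, or `Σ 1/γᵢ < 0`») (arXiv:1508.01507 p0005 L116–L140, p0008 L1–L20); Chiang1995, §6 Theorem 6.7 (R1)] -/
theorem ring_type_auxJac_of_sum_inv_neg (hm : 2 ≤ m) (hD : ∀ i, 0 < Kur.D i)
    (hP : ∀ i j, Kur.P i j = Kur.P j i)
    (hsupp : ∀ i j, Kur.P i j ≠ 0 → j = finRotate (m + 1) i ∨ i = finRotate (m + 1) j)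
    (θ : Fin (m + 1) → ℝ) (hnd : ∀ i, Kur.P i (finRotate (m + 1) i) * Real.cos (θ i - θ (finRotate (m + 1) i)) ≠ 0)
    (hS : ∑ i, 1 / (Kur.P i (finRotate (m + 1) i) * Real.cos (θ i - θ (finRotate (m + 1) i))) < 0) :
    ((Kur.toDroopNetwork.auxJac θ).map (algebraMap ℝ ℂ)).charpoly.roots.countP (fun μ => 0 < μ.re)
        = (univ.filter fun i => Kur.P i (finRotate (m + 1) i) * Real.cos (θ i - θ (finRotate (m + 1) i)) < 0).card - 1
      ∧ ((Kur.toDroopNetwork.auxJac θ).map (algebraMap ℝ ℂ)).charpoly.roots.countP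
          (fun μ => μ.re < 0) = m + 1 - (univ.filter fun i => Kur.P i (finRotate (m + 1) i) * Real.cos (θ i - θ (finRotate (m + 1) i)) < 0).card
      ∧ ((Kur.toDroopNetwork.auxJac θ).map (algebraMap ℝ ℂ)).charpoly.roots.countP
          (fun μ => μ.re = 0) = 1 := by
  classical
  have hL : (Kur.toDroopNetwork.lap θ).IsHermitian :=
    DroopNetwork.lap_isHermitian (N := Kur.toDroopNetwork) (fun i j => hP i j) θ
  obtain ⟨h1, h2, h3⟩ := SignedCycle.inertia_of_sum_inv_neg hnd hL (Kur.ring_lap_form hm hP hsupp θ) hS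
  have hrow : ∀ i, ∑ l, Kur.toDroopNetwork.lap θ i l = 0 :=
    fun i => DroopNetwork.sum_lap_row (N := Kur.toDroopNetwork) θ i
  have hHm := refMinor_isHermitian hL 0
  obtain ⟨r1, r2, -, hreg⟩ := RefNode.refMinor_counts hL hrow h2 0 hHm
  obtain ⟨t1, t2, t3⟩ := Kur.countP_roots_charpoly_toDroopNetwork_auxJac hP hD θ 0 hHm hreg
  refine ⟨?_, ?_, t3⟩
  · rw [t1, r2, h1]
  · rw [t2, r1, h3]

/-- ★★ **AT THE CROSSING `Σᵢ 1/γᵢ = 0` the fixed point is degenerate:** the stability matrix `L(θ)`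
has exactly `j − 1` negative eigenvalues, a DOUBLE zero (the rotation and the unit-current
direction) and `m − j` positive ones — it is not hyperbolic modulo rotation, and no type is assigned.
[cite: BronskiDeVilleFerguson2016, §2.2 Theorems 2.6 and 2.8, §3.2 (arXiv:1508.01507 p0005 L116–L140, p0006 L56–L76, p0008 L1–L20)] -/
theorem ring_inertia_lap_of_sum_inv_eq_zero (hm : 2 ≤ m) (hP : ∀ i j, Kur.P i j = Kur.P j i)
    (hsupp : ∀ i j, Kur.P i j ≠ 0 → j = finRotate (m + 1) i ∨ i = finRotate (m + 1) j)
    (θ : Fin (m + 1) → ℝ) (hnd : ∀ i, Kur.P i (finRotate (m + 1) i) * Real.cos (θ i - θ (finRotate (m + 1) i)) ≠ 0)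
    (hS : ∑ i, 1 / (Kur.P i (finRotate (m + 1) i) * Real.cos (θ i - θ (finRotate (m + 1) i))) = 0) (hL : (Kur.toDroopNetwork.lap θ).IsHermitian) :
    (univ.filter fun k => hL.eigenvalues k < 0).card = (univ.filter fun i => Kur.P i (finRotate (m + 1) i) * Real.cos (θ i - θ (finRotate (m + 1) i)) < 0).card - 1
      ∧ (univ.filter fun k => hL.eigenvalues k = 0).card = 2
      ∧ (univ.filter fun k => 0 < hL.eigenvalues k).card
          = m - (univ.filter fun i => Kur.P i (finRotate (m + 1) i) * Real.cos (θ i - θ (finRotate (m + 1) i)) < 0).card :=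
  SignedCycle.inertia_of_sum_inv_eq_zero hnd hL (Kur.ring_lap_form hm hP hsupp θ) hS

end NonuniformKuramoto

/-! ### §8. THE MODEL, swing tier: the classical lossless swing ring -/

namespace ClassicalModel

namespace LosslessSystem

open Literature.LinearAlgebra.Matrix (refMinor refMinor_isHermitian)

variable {m : ℕ} (S : LosslessSystem (m + 1) 0)

/-- The Hesse matrix of a ring-supported swing network carries the cycle form.
[cite: BronskiDeVilleFerguson2016, §1.1 eq. (swing equations) and §2.1 Lemma 2.5 (arXiv:1508.01507 p0003 L95–L110, p0005 L89–L112)] -/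
theorem ring_hessMatrix_form (hm : 2 ≤ m) (hC : ∀ i j, S.C i j = S.C j i)
    (hsupp : ∀ i j, S.C i j ≠ 0 → j = finRotate (m + 1) i ∨ i = finRotate (m + 1) j)
    (θ x : Fin (m + 1) → ℝ) :
    x ⬝ᵥ S.hessMatrix θ *ᵥ x
      = ∑ i, (S.C i (finRotate (m + 1) i) * Real.cos (θ i - θ (finRotate (m + 1) i))) * (x (finRotate (m + 1) i) - x i) ^ 2 := by
  rw [S.hessMatrix_form θ x]
  exact SignedCycle.ring_linForm_eq_sum_rotate hm hC hsupp θ x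

/-- ★★★ **A SYNCHRONOUS STATE OF THE SWING RING WITH `j` INVERTED LINES AND `Σᵢ 1/γᵢ > 0` HAS TYPE
EXACTLY `j`** (`Mᵢ, Dᵢ > 0`, any injections; `γᵢ = C_{i,ρi}cos(θᵢ − θ_{ρi}) ≠ 0`): the swing
Jacobian at `(θ, 0)` has exactly `j` roots in the open right half-plane, `(m − j) + (m + 1)` in the
open left half-plane and one on the axis.
[cite: BronskiDeVilleFerguson2016, §1.1 eq. (swing) («In each of these examples the dimension of the unstable manifold … is given by the number of positive eigenvalues of a graph Laplacian»), §2.2 Theorem 2.6, §3.2 (arXiv:1508.01507 p0003 L95–L110, p0005 L116–L140, p0007–p0008 §3.2); Chiang1995, §6.3 Theorem 6.1] -/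
theorem ring_type_phaseJac_of_sum_inv_pos (hm : 2 ≤ m) (hM : ∀ i, 0 < S.M i) (hD : ∀ i, 0 < S.D i)
    (hC : ∀ i j, S.C i j = S.C j i)
    (hsupp : ∀ i j, S.C i j ≠ 0 → j = finRotate (m + 1) i ∨ i = finRotate (m + 1) j)
    (θ : Fin (m + 1) → ℝ) (hnd : ∀ i, S.C i (finRotate (m + 1) i) * Real.cos (θ i - θ (finRotate (m + 1) i)) ≠ 0)
    (hS : 0 < ∑ i, 1 / (S.C i (finRotate (m + 1) i) * Real.cos (θ i - θ (finRotate (m + 1) i)))) :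
    ((S.phaseJac θ).map (algebraMap ℝ ℂ)).charpoly.roots.countP (fun μ => 0 < μ.re)
        = (univ.filter fun i => S.C i (finRotate (m + 1) i) * Real.cos (θ i - θ (finRotate (m + 1) i)) < 0).card
      ∧ ((S.phaseJac θ).map (algebraMap ℝ ℂ)).charpoly.roots.countP (fun μ => μ.re < 0)
        = m - (univ.filter fun i => S.C i (finRotate (m + 1) i) * Real.cos (θ i - θ (finRotate (m + 1) i)) < 0).card + (m + 1)
      ∧ ((S.phaseJac θ).map (algebraMap ℝ ℂ)).charpoly.roots.countP (fun μ => μ.re = 0) = 1 := by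
  classical
  have hH : (S.hessMatrix θ).IsHermitian := S.hessMatrix_isHermitian hC θ
  obtain ⟨h1, h2, h3⟩ := SignedCycle.inertia_of_sum_inv_pos hnd hH (S.ring_hessMatrix_form hm hC hsupp θ) hS
  have hrow : ∀ i, ∑ l, S.hessMatrix θ i l = 0 := fun i => sum_hessMatrix_row S θ i
  have hHm := refMinor_isHermitian hH 0
  obtain ⟨r1, r2, -, hreg⟩ := RefNode.refMinor_counts hH hrow h2 0 hHm
  obtain ⟨t1, t2, t3⟩ := S.countP_roots_charpoly_phaseJac_modRotation hM hD hC θ 0 hHm hreg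
  refine ⟨?_, ?_, t3⟩
  · rw [t1, r2, h1]
  · rw [t2, r1, h3]

/-- ★★★ **… AND WITH `Σᵢ 1/γᵢ < 0` TYPE EXACTLY `j − 1`**: `j − 1` roots in the open right half-plane,
`(m + 1 − j) + (m + 1)` in the open left half-plane, one on the axis.
[cite: BronskiDeVilleFerguson2016, §2.2 Theorem 2.6, §3.2 (arXiv:1508.01507 p0005 L116–L140, p0008 L1–L20); Chiang1995, §6.3 Theorem 6.1] -/
theorem ring_type_phaseJac_of_sum_inv_neg (hm : 2 ≤ m) (hM : ∀ i, 0 < S.M i) (hD : ∀ i, 0 < S.D i)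
    (hC : ∀ i j, S.C i j = S.C j i)
    (hsupp : ∀ i j, S.C i j ≠ 0 → j = finRotate (m + 1) i ∨ i = finRotate (m + 1) j)
    (θ : Fin (m + 1) → ℝ) (hnd : ∀ i, S.C i (finRotate (m + 1) i) * Real.cos (θ i - θ (finRotate (m + 1) i)) ≠ 0)
    (hS : ∑ i, 1 / (S.C i (finRotate (m + 1) i) * Real.cos (θ i - θ (finRotate (m + 1) i))) < 0) :
    ((S.phaseJac θ).map (algebraMap ℝ ℂ)).charpoly.roots.countP (fun μ => 0 < μ.re)
        = (univ.filter fun i => S.C i (finRotate (m + 1) i) * Real.cos (θ i - θ (finRotate (m + 1) i)) < 0).card - 1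
      ∧ ((S.phaseJac θ).map (algebraMap ℝ ℂ)).charpoly.roots.countP (fun μ => μ.re < 0)
        = m + 1 - (univ.filter fun i => S.C i (finRotate (m + 1) i) * Real.cos (θ i - θ (finRotate (m + 1) i)) < 0).card + (m + 1)
      ∧ ((S.phaseJac θ).map (algebraMap ℝ ℂ)).charpoly.roots.countP (fun μ => μ.re = 0) = 1 := by
  classical
  have hH : (S.hessMatrix θ).IsHermitian := S.hessMatrix_isHermitian hC θ
  obtain ⟨h1, h2, h3⟩ := SignedCycle.inertia_of_sum_inv_neg hnd hH (S.ring_hessMatrix_form hm hC hsupp θ) hS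
  have hrow : ∀ i, ∑ l, S.hessMatrix θ i l = 0 := fun i => sum_hessMatrix_row S θ i
  have hHm := refMinor_isHermitian hH 0
  obtain ⟨r1, r2, -, hreg⟩ := RefNode.refMinor_counts hH hrow h2 0 hHm
  obtain ⟨t1, t2, t3⟩ := S.countP_roots_charpoly_phaseJac_modRotation hM hD hC θ 0 hHm hreg
  refine ⟨?_, ?_, t3⟩
  · rw [t1, r2, h1]
  · rw [t2, r1, h3]

end LosslessSystem

end ClassicalModel

end Literature.MathematicalPhysics.PowerSystems

end
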